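/-
Copyright (c) 2026 the pub-hodgecm-mathlib formalisation cell (harness21).  Prover seat hodgecm-mathlib-K2E4-p23 (g2), Track B ∕ K2-LIT, h413 =
`stmt-HodgeConjecture-24833`, ENGINE E1, 5Res campaign, deal (80) «(d) ARCH-UNITARITY FILE 2 + FILE 3» of the dealer K2E1-plan (g6) 2026-09-04T10:34:42Z: FILE 2b-2, the SECOND-ORDER
EXPANSION of the torus coefficient `Φ_{s,m}` at the identity and the ASSEMBLED arch-unitarity theorem.
-/
import Summits.HodgeConjecture.HodgeConjecture.Theorems.K2E1ArchTorusCoefficientDerivativesU11   -- ★ (this seat) F2b-1: `E_u = E·A`, `(E·A)_u = E·(A² + A_u)`, values at 0, joint continuity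
import Summits.HodgeConjecture.HodgeConjecture.Theorems.K2E1ArchUnitarityOfMatrixCoefficient     -- ★ p859467 (this seat) F3: `im_eq_zero_of_isUnitary_matrixCoeff`, `…_rightRegular_…`
import Mathlib.Analysis.Calculus.ParametricIntervalIntegral
import Mathlib.Analysis.SpecialFunctions.Integrals.Basic
import HarnessLib

/-!
# K2·E1 — `K2E1ArchTorusCoefficientExpansionU11`: `Φ_{s,m}(e^u)` IS TWICE DIFFERENTIABLE AT `u = 0` WITH SECOND DERIVATIVE `2(s² − s − m²∕4)` (the Casimir scalar); HENCE
# «`Φ_{s,m}` REAL ON `a > 0` ⟹ `Im(s² − s) = 0` ⟹ `Im s = 0 ∨ Re s = ½`», AND THE ASSEMBLED ARCH-UNITARITY THEOREM (FILE 2b-2 = the head of (d))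

Track B ∕ K2-LIT, crux h413 = `stmt-HodgeConjecture-24833`, route of record `HCCMUnconditional`; cell `hodgecm-mathlib`, squad K2, ENGINE E1 (5Res campaign
«BL-2(χ,τ) ∘ MS-2(χ,τ) ∘ ARCH-UNITARITY ∘ R8₂», this seat's census (45c)).  Prover seat `hodgecm-mathlib-K2E4-p23` (g2); deal (80) of the dealer K2E1-plan (g6).  THEOREMS ONLY (no `def`,
no `instance`, no notation, no named-fact hypothesis, no `sorry`); lane `--supports stmt-HodgeConjecture-24833 --as helper` (count-neutral).  CLOSES NO SOCKET.

THE RESULT [Knapp1986, VII §1; Bump1997, §2.6 Thm. 2.6.3; MoeglinWaldspurger1995, IV.3, V.3.13].  For the diagonal matrix coefficient `Φ_{s,m}(a)` of the principal series of `U(1,1)(ℝ)`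
along the split torus (★ `archTorusCoeff`, defs leaf p859448∕ED. 2):
* §1 DIFFERENTIATION UNDER `∫_0^{2π}` (Mathlib `intervalIntegral.hasDerivAt_integral_of_dominated_loc_of_deriv_le`, bounds by compactness from the joint continuity of ★ F2b-1 §4):
  `u ↦ ∫ E_{s,m}(u,θ) dθ` has derivative `∫ E·A` everywhere, and `u ↦ ∫ E·A` has derivative `∫ E·(A² + A_u)` everywhere.
* §2 THE VALUE AT `u = 0`: `∫_0^{2π} (A(0,θ)² + A_u(0,θ)) dθ = 2π·2(s² − s − m²∕4)` (`∫cos² = ∫sin² = π`, `∫sin·cos = 0`; `e^{iθ} = cos θ + i sin θ`).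
* §3 HEADS: **`exists_hasDerivAt_archTorusCoeff_exp`** (`∃ F₁, (∀ u, HasDerivAt (u ↦ Φ_{s,m}(e^u)) (F₁ u) u) ∧ HasDerivAt F₁ (2(s² − s − m²∕4)) 0` — the expansion
  `Φ_{s,m}(e^u) = 1 + (s² − s − m²∕4)u² + o(u²)` in derivative form), **`im_sq_sub_self_eq_zero_of_forall_im_archTorusCoeff_eq_zero`** (if `Φ_{s,m}(a)` is real for all `a > 0` then
  `Im(s² − s) = 0`: the imaginary part of a locally-zero differentiable function has zero derivative — twice), **`im_eq_zero_or_re_eq_half_of_forall_im_archTorusCoeff_eq_zero`**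
  (`Im(s² − s) = Im s·(2 Re s − 1)`), and the ASSEMBLED **`arch_unitarity_of_matrixCoeff`** ∕ **`arch_unitarity_of_rightRegular_matrixCoeff`**: a unitary representation (e.g. `R` on
  `L²(G(F)∖G(𝔸))`), an inversion-closed family `t` (the torus at one real place), `ψ ≠ 0` with `⟪ρ(t a)ψ, ψ⟫ = Φ_{s,m}(a)‖ψ‖²` (letter `hmc`) FORCE **`Im s = 0 ∨ Re s = ½`** — for the arch datum
  `s = z₀ + it_v` of a residual pole `z₀ ∈ (½, 1]`: **`t_v = 0`**.  This is the pole COUNT per `K`-type of the 5Res campaign with no `L`-function (census (45c) (2)(ii)).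
HONEST LABEL: HC_CM is proved only modulo the 7 printed citations (2 remaining named inputs: hLiu418 = `stmt-HodgeConjecture-24832`, h413 = `stmt-HodgeConjecture-24833`) until rung 0
closes; this file asserts no named fact and closes no socket; count-neutral.

## References
* [Knapp1986] A. W. Knapp, *Representation Theory of Semisimple Groups* (1986), VII §1.
* [Bump1997] D. Bump, *Automorphic Forms and Representations* (1997), §2.6 Thm. 2.6.3.
* [MoeglinWaldspurger1995] C. Mœglin, J.-L. Waldspurger, *Spectral Decomposition and Eisenstein Series* (1995), IV.3, V.3.13.
-/

set_option autoImplicit false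
-- the mandated namespace repeats the single-problem summit's segment (`HodgeConjecture.HodgeConjecture`)
set_option linter.dupNamespace false

noncomputable section

open Real Complex MeasureTheory Set Filter Topology intervalIntegral
open scoped InnerProductSpace
open Summit.HodgeConjecture.HodgeConjecture.Cruxes.H413.K2E1ArchTorusCoefficientU11Defs
open Summit.HodgeConjecture.HodgeConjecture.Cruxes.H413.K2E1ArchTorusCoefficientDerivativesU11
open Summit.HodgeConjecture.HodgeConjecture.Cruxes.H413.K2E1ArchUnitarityOfMatrixCoefficient

namespace Summit.HodgeConjecture.HodgeConjecture.Cruxes.H413.K2E1ArchTorusCoefficientExpansionU11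

/-! ## §1 Differentiation under the integral sign (twice) -/

/-- **GENERIC DOMINATED DIFFERENTIATION ON `[0, 2π]` FROM JOINT CONTINUITY.**  If `F, F' : ℝ → ℝ → ℂ` are jointly continuous and `∂_x F(x,θ) = F'(x,θ)` everywhere, then
`x ↦ ∫_0^{2π} F(x,θ) dθ` has derivative `∫_0^{2π} F'(x₀,θ) dθ` at every `x₀` (the bound on `F'` over `[x₀−1, x₀+1] × [0, 2π]` comes from compactness). [folklore] -/
theorem hasDerivAt_intervalIntegral_of_continuous (F F' : ℝ → ℝ → ℂ) (hF : Continuous fun p : ℝ × ℝ => F p.1 p.2) (hF' : Continuous fun p : ℝ × ℝ => F' p.1 p.2)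
    (hderiv : ∀ x θ, HasDerivAt (fun x => F x θ) (F' x θ) x) (x₀ : ℝ) :
    HasDerivAt (fun x => ∫ θ in (0 : ℝ)..2 * π, F x θ) (∫ θ in (0 : ℝ)..2 * π, F' x₀ θ) x₀ := by
  -- a uniform bound for `F'` on the compact box `[x₀ - 1, x₀ + 1] × [0, 2π]`
  have hK : IsCompact (Icc (x₀ - 1) (x₀ + 1) ×ˢ Icc (0 : ℝ) (2 * π)) := isCompact_Icc.prod isCompact_Icc
  obtain ⟨C, hC⟩ := hK.exists_bound_of_continuousOn hF'.continuousOn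
  have hcontθ : ∀ x, Continuous fun θ => F x θ := fun x => hF.comp (Continuous.prodMk continuous_const continuous_id)
  have hcontθ' : ∀ x, Continuous fun θ => F' x θ := fun x => hF'.comp (Continuous.prodMk continuous_const continuous_id)
  refine (intervalIntegral.hasDerivAt_integral_of_dominated_loc_of_deriv_le (F := F) (F' := F') (x₀ := x₀) (bound := fun _ => C)
    (s := Icc (x₀ - 1) (x₀ + 1)) (Icc_mem_nhds (by linarith) (by linarith)) ?_ ?_ ?_ ?_ ?_ ?_).2
  · exact Eventually.of_forall fun x => (hcontθ x).aestronglyMeasurable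
  · exact (hcontθ x₀).intervalIntegrable _ _
  · exact (hcontθ' x₀).aestronglyMeasurable
  · refine Eventually.of_forall fun θ hθ x hx => hC (x, θ) ⟨hx, ?_⟩
    have h2π : (0 : ℝ) ≤ 2 * π := by positivity
    rw [uIoc_of_le h2π] at hθ
    exact ⟨hθ.1.le, hθ.2⟩
  · exact intervalIntegrable_const
  · exact Eventually.of_forall fun θ _ x _ => hderiv x θ

/-! ## §2 The trigonometric integrals at `u = 0` -/

/-- `∫_0^{2π} cos² = π`. [folklore] -/
theorem integral_cos_sq_two_pi : ∫ θ in (0 : ℝ)..2 * π, Real.cos θ ^ 2 = π := by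
  rw [integral_cos_sq]; simp

/-- `∫_0^{2π} sin² = π`. [folklore] -/
theorem integral_sin_sq_two_pi : ∫ θ in (0 : ℝ)..2 * π, Real.sin θ ^ 2 = π := by
  rw [integral_sin_sq]; simp

/-- `∫_0^{2π} sin·cos = 0`. [folklore] -/
theorem integral_sin_mul_cos_two_pi : ∫ θ in (0 : ℝ)..2 * π, Real.sin θ * Real.cos θ = 0 := by
  rw [integral_sin_mul_cos₁]; simp

/-- **THE CASIMIR SCALAR.**  `∫_0^{2π} (A(0,θ)² + A_u(0,θ)) dθ = 2π·2(s² − s − m²∕4)` where `A(0,θ) = c(−2cos θ) + m(−e^{iθ})`, `A_u(0,θ) = c(4 − 4cos²θ) + m(1 − e^{2iθ})`, `c = −s − m∕2`.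
[cite: Knapp1986, VII §1] [cite: Bump1997, §2.6 Thm. 2.6.3] -/
theorem integral_logDeriv_sq_add_deriv_zero (s : ℂ) (m : ℤ) :
    ∫ θ in (0 : ℝ)..2 * π,
      (((-s - (m : ℂ) / 2) * (-2 * (Real.cos θ : ℂ)) + (m : ℂ) * (-Complex.exp (θ * Complex.I))) *
          ((-s - (m : ℂ) / 2) * (-2 * (Real.cos θ : ℂ)) + (m : ℂ) * (-Complex.exp (θ * Complex.I))) +
        ((-s - (m : ℂ) / 2) * (4 - 4 * (Real.cos θ : ℂ) ^ 2) + (m : ℂ) * (1 - Complex.exp (θ * Complex.I) * Complex.exp (θ * Complex.I)))) =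
      2 * π * (2 * (s ^ 2 - s - (m : ℂ) ^ 2 / 4)) := by
  -- rewrite the integrand as `α₀ + α₁ cos² + α₂ sin² + α₃ sin·cos` with `e^{iθ} = cos θ + i sin θ`
  set c : ℂ := -s - (m : ℂ) / 2 with hc
  have hpt : ∀ θ : ℝ,
      ((c * (-2 * (Real.cos θ : ℂ)) + (m : ℂ) * (-Complex.exp (θ * Complex.I))) * ((c * (-2 * (Real.cos θ : ℂ)) + (m : ℂ) * (-Complex.exp (θ * Complex.I)))) +
        (c * (4 - 4 * (Real.cos θ : ℂ) ^ 2) + (m : ℂ) * (1 - Complex.exp (θ * Complex.I) * Complex.exp (θ * Complex.I)))) =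
      (4 * c + m) + (4 * c ^ 2 + 4 * c * m + (m : ℂ) ^ 2 - 4 * c - m) * ((Real.cos θ ^ 2 : ℝ) : ℂ) + ((m : ℂ) - (m : ℂ) ^ 2) * ((Real.sin θ ^ 2 : ℝ) : ℂ) +
        ((4 * c * m + 2 * (m : ℂ) ^ 2 - 2 * m) * Complex.I) * ((Real.sin θ * Real.cos θ : ℝ) : ℂ) := by
    intro θ
    have hexp : Complex.exp (θ * Complex.I) = (Real.cos θ : ℂ) + (Real.sin θ : ℂ) * Complex.I := by
      rw [Complex.exp_mul_I, ← Complex.ofReal_cos, ← Complex.ofReal_sin]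
    rw [hexp]
    push_cast
    have hI : Complex.I * Complex.I = -1 := Complex.I_mul_I
    ring_nf
    rw [Complex.I_sq]
    ring
  simp_rw [hpt]
  have hc1 : Continuous fun θ : ℝ => ((Real.cos θ ^ 2 : ℝ) : ℂ) := by fun_prop
  have hc2 : Continuous fun θ : ℝ => ((Real.sin θ ^ 2 : ℝ) : ℂ) := by fun_prop
  have hc3 : Continuous fun θ : ℝ => ((Real.sin θ * Real.cos θ : ℝ) : ℂ) := by fun_prop
  rw [intervalIntegral.integral_add, intervalIntegral.integral_add, intervalIntegral.integral_add, intervalIntegral.integral_const,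
    intervalIntegral.integral_const_mul, intervalIntegral.integral_const_mul, intervalIntegral.integral_const_mul,
    intervalIntegral.integral_ofReal, intervalIntegral.integral_ofReal, intervalIntegral.integral_ofReal,
    integral_cos_sq_two_pi, integral_sin_sq_two_pi, integral_sin_mul_cos_two_pi]
  · simp only [sub_zero, Complex.real_smul, Complex.ofReal_zero, mul_zero, add_zero]
    rw [hc]
    push_cast
    ring
  all_goals first
    | exact intervalIntegrable_const
    | exact ((hc1.const_mul _).intervalIntegrable _ _)
    | exact ((hc2.const_mul _).intervalIntegrable _ _)
    | exact ((hc3.const_mul _).intervalIntegrable _ _)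
    | exact (continuous_const.add (hc1.const_mul _)).intervalIntegrable _ _
    | exact ((continuous_const.add (hc1.const_mul _)).add (hc2.const_mul _)).intervalIntegrable _ _

/-! ## §3 The heads -/

/-- **THE SECOND-ORDER EXPANSION OF `Φ_{s,m}` AT THE IDENTITY, IN DERIVATIVE FORM**: there is `F₁ : ℝ → ℂ` with `(Φ_{s,m} ∘ exp)′ = F₁` everywhere and `F₁′(0) = 2(s² − s − m²∕4)` — i.e.
`Φ_{s,m}(e^u) = 1 + (s² − s − m²∕4)·u² + o(u²)` (`Φ_{s,m}(1) = 1`, `F₁(0) = 0`).  [cite: Knapp1986, VII §1] [cite: Bump1997, §2.6 Thm. 2.6.3] -/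
theorem exists_hasDerivAt_archTorusCoeff_exp (s : ℂ) (m : ℤ) :
    ∃ F₁ : ℝ → ℂ, (∀ u : ℝ, HasDerivAt (fun u : ℝ => archTorusCoeff s m (Real.exp u)) (F₁ u) u) ∧
      HasDerivAt F₁ (2 * (s ^ 2 - s - (m : ℂ) ^ 2 / 4)) 0 := by
  -- the integrand `E`, its logarithmic derivative form `E·A` and `E·(A² + A_u)` as two-variable functions
  let E : ℝ → ℝ → ℂ := fun u θ => archTorusExpIntegrand s m u θ
  let EA : ℝ → ℝ → ℂ := fun u θ => archTorusExpIntegrand s m u θ *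
    ((-s - (m : ℂ) / 2) * ((((torusQ u θ)⁻¹ * (2 * Real.sinh (2 * u) - Real.cos θ * (2 * Real.cosh (2 * u))) : ℝ) : ℂ)) +
      (m : ℂ) * ((((Real.sinh u : ℝ) : ℂ) - Complex.exp (θ * Complex.I) * ((Real.cosh u : ℝ) : ℂ)) / torusP u θ))
  let EB : ℝ → ℝ → ℂ := fun u θ => archTorusExpIntegrand s m u θ *
      ((-s - (m : ℂ) / 2) * ((((torusQ u θ)⁻¹ * (2 * Real.sinh (2 * u) - Real.cos θ * (2 * Real.cosh (2 * u))) : ℝ) : ℂ)) +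
        (m : ℂ) * ((((Real.sinh u : ℝ) : ℂ) - Complex.exp (θ * Complex.I) * ((Real.cosh u : ℝ) : ℂ)) / torusP u θ)) *
      ((-s - (m : ℂ) / 2) * ((((torusQ u θ)⁻¹ * (2 * Real.sinh (2 * u) - Real.cos θ * (2 * Real.cosh (2 * u))) : ℝ) : ℂ)) +
        (m : ℂ) * ((((Real.sinh u : ℝ) : ℂ) - Complex.exp (θ * Complex.I) * ((Real.cosh u : ℝ) : ℂ)) / torusP u θ)) +
    archTorusExpIntegrand s m u θ *
      ((-s - (m : ℂ) / 2) * (((((4 * torusQ u θ) * torusQ u θ -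
          (2 * Real.sinh (2 * u) - Real.cos θ * (2 * Real.cosh (2 * u))) * (2 * Real.sinh (2 * u) - Real.cos θ * (2 * Real.cosh (2 * u)))) /
          (torusQ u θ) ^ 2 : ℝ)) : ℂ) +
      (m : ℂ) * ((torusP u θ * torusP u θ -
          (((Real.sinh u : ℝ) : ℂ) - Complex.exp (θ * Complex.I) * ((Real.cosh u : ℝ) : ℂ)) *
            (((Real.sinh u : ℝ) : ℂ) - Complex.exp (θ * Complex.I) * ((Real.cosh u : ℝ) : ℂ))) / (torusP u θ) ^ 2))
  have hE : Continuous fun p : ℝ × ℝ => E p.1 p.2 := continuous_archTorusExpIntegrand₂ s m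
  have hEA : Continuous fun p : ℝ × ℝ => EA p.1 p.2 := (continuous_archTorusExpIntegrand₂ s m).mul (continuous_logDeriv₂ s m)
  have hEB : Continuous fun p : ℝ × ℝ => EB p.1 p.2 :=
    (((continuous_archTorusExpIntegrand₂ s m).mul (continuous_logDeriv₂ s m)).mul (continuous_logDeriv₂ s m)).add
      ((continuous_archTorusExpIntegrand₂ s m).mul (continuous_logDeriv_deriv₂ s m))
  have hdE : ∀ u θ, HasDerivAt (fun u => E u θ) (EA u θ) u := fun u θ => hasDerivAt_archTorusExpIntegrand s m u θ
  have hdEA : ∀ u θ, HasDerivAt (fun u => EA u θ) (EB u θ) u := fun u θ => hasDerivAt_archTorusExpIntegrand_mul_logDeriv s m u θ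
  -- the two dominated differentiations
  have h1 : ∀ u₀, HasDerivAt (fun u => ∫ θ in (0 : ℝ)..2 * π, E u θ) (∫ θ in (0 : ℝ)..2 * π, EA u₀ θ) u₀ :=
    hasDerivAt_intervalIntegral_of_continuous E EA hE hEA hdE
  have h2 : HasDerivAt (fun u => ∫ θ in (0 : ℝ)..2 * π, EA u θ) (∫ θ in (0 : ℝ)..2 * π, EB 0 θ) 0 :=
    hasDerivAt_intervalIntegral_of_continuous EA EB hEA hEB hdEA 0
  -- the value at `0`
  have hEB0 : (∫ θ in (0 : ℝ)..2 * π, EB 0 θ) = 2 * π * (2 * (s ^ 2 - s - (m : ℂ) ^ 2 / 4)) := by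
    have hpt : ∀ θ : ℝ, EB 0 θ =
        (((-s - (m : ℂ) / 2) * (-2 * (Real.cos θ : ℂ)) + (m : ℂ) * (-Complex.exp (θ * Complex.I))) *
            ((-s - (m : ℂ) / 2) * (-2 * (Real.cos θ : ℂ)) + (m : ℂ) * (-Complex.exp (θ * Complex.I))) +
          ((-s - (m : ℂ) / 2) * (4 - 4 * (Real.cos θ : ℂ) ^ 2) + (m : ℂ) * (1 - Complex.exp (θ * Complex.I) * Complex.exp (θ * Complex.I)))) := by
      intro θ
      simp only [EB]
      rw [archTorusExpIntegrand_zero, one_mul, one_mul, logDeriv_zero, logDeriv_deriv_zero]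
    simp_rw [hpt]
    exact integral_logDeriv_sq_add_deriv_zero s m
  refine ⟨fun u => ((2 * π)⁻¹ : ℝ) • ∫ θ in (0 : ℝ)..2 * π, EA u θ, fun u₀ => ?_, ?_⟩
  · have hfun : (fun u : ℝ => archTorusCoeff s m (Real.exp u)) = fun u => ((2 * π)⁻¹ : ℝ) • ∫ θ in (0 : ℝ)..2 * π, E u θ := by
      funext u; exact archTorusCoeff_exp s m u
    rw [hfun]
    exact (h1 u₀).const_smul ((2 * π)⁻¹ : ℝ)
  · have h := h2.const_smul ((2 * π)⁻¹ : ℝ)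
    rw [hEB0] at h
    have hπ : ((π : ℝ) : ℂ) ≠ 0 := Complex.ofReal_ne_zero.2 Real.pi_pos.ne'
    have e : ((2 * π)⁻¹ : ℝ) • (2 * (π : ℂ) * (2 * (s ^ 2 - s - (m : ℂ) ^ 2 / 4))) = 2 * (s ^ 2 - s - (m : ℂ) ^ 2 / 4) := by
      rw [Complex.real_smul]
      push_cast
      field_simp
    rw [e] at h
    exact h

/-- The imaginary part of a real-differentiable `ℂ`-valued function with identically vanishing imaginary part has vanishing derivative-imaginary-part. [folklore] -/
theorem im_eq_zero_of_hasDerivAt_of_forall_im_eq_zero {F : ℝ → ℂ} {F' : ℂ} {x : ℝ} (hF : HasDerivAt F F' x) (h0 : ∀ y, (F y).im = 0) :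
    F'.im = 0 := by
  have h1 : HasDerivAt (fun y => (F y).im) F'.im x := Complex.imCLM.hasFDerivAt.comp_hasDerivAt x hF
  have h2 : HasDerivAt (fun y => (F y).im) 0 x := by
    have hconst : (fun y => (F y).im) = fun _ => (0 : ℝ) := funext h0
    rw [hconst]
    exact hasDerivAt_const x (0 : ℝ)
  exact h1.unique h2

/-- **IF `Φ_{s,m}` IS REAL ON `a > 0` THEN `Im(s² − s) = 0`.**  Reality along the torus kills the imaginary part of `u ↦ Φ_{s,m}(e^u)`, hence of its first derivative everywhere, hence of
the second derivative `2(s² − s − m²∕4)` at `0`; `m²∕4` is real.  [cite: Bump1997, §2.6 Thm. 2.6.3] [cite: Knapp1986, VII §1] -/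
theorem im_sq_sub_self_eq_zero_of_forall_im_archTorusCoeff_eq_zero {s : ℂ} {m : ℤ} (h : ∀ a : ℝ, 0 < a → (archTorusCoeff s m a).im = 0) :
    (s ^ 2 - s).im = 0 := by
  obtain ⟨F₁, hF₁, hF₂⟩ := exists_hasDerivAt_archTorusCoeff_exp s m
  have him1 : ∀ u, (F₁ u).im = 0 := fun u =>
    im_eq_zero_of_hasDerivAt_of_forall_im_eq_zero (hF₁ u) fun y => h _ (Real.exp_pos y)
  have him2 : (2 * (s ^ 2 - s - (m : ℂ) ^ 2 / 4)).im = 0 := im_eq_zero_of_hasDerivAt_of_forall_im_eq_zero hF₂ him1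
  have hm : ((m : ℂ) ^ 2 / 4).im = 0 := by
    rw [show ((m : ℂ) ^ 2 / 4) = (((m : ℝ) ^ 2 / 4 : ℝ) : ℂ) by push_cast; ring]
    exact Complex.ofReal_im _
  have : (2 * (s ^ 2 - s - (m : ℂ) ^ 2 / 4)).im = 2 * (s ^ 2 - s).im := by
    rw [Complex.mul_im]
    simp [Complex.sub_im, hm]
  rw [this] at him2
  linarith

/-- `Im(s² − s) = Im s·(2 Re s − 1)`; so `Im(s² − s) = 0` iff `Im s = 0 ∨ Re s = ½`. [folklore] -/
theorem im_sq_sub_self (s : ℂ) : (s ^ 2 - s).im = s.im * (2 * s.re - 1) := by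
  rw [Complex.sub_im, pow_two, Complex.mul_im]; ring

/-- **IF `Φ_{s,m}` IS REAL ON `a > 0` THEN `Im s = 0 ∨ Re s = ½`** (real parameter or the unitary axis). [cite: Bump1997, §2.6 Thm. 2.6.3] [cite: MoeglinWaldspurger1995, IV.3] -/
theorem im_eq_zero_or_re_eq_half_of_forall_im_archTorusCoeff_eq_zero {s : ℂ} {m : ℤ} (h : ∀ a : ℝ, 0 < a → (archTorusCoeff s m a).im = 0) :
    s.im = 0 ∨ s.re = 1 / 2 := by
  have h0 := im_sq_sub_self_eq_zero_of_forall_im_archTorusCoeff_eq_zero h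
  rw [im_sq_sub_self] at h0
  rcases mul_eq_zero.1 h0 with h1 | h1
  · exact Or.inl h1
  · exact Or.inr (by linarith)

/-- **ARCH-UNITARITY (assembled, abstract unitary representation).**  Let `π` be a unitary representation of a group `G` on a Hilbert space, `t : ℝ → G` with `t a⁻¹ = (t a)⁻¹` (`a > 0`),
`ψ ≠ 0`, and suppose the diagonal matrix coefficient along `t` is the `U(1,1)` torus coefficient: `⟪π (t a) ψ, ψ⟫ = Φ_{s,m}(a)·‖ψ‖²` for `a > 0` (letter `hmc`: `ψ` a residual vector of arch
datum `s = z₀ + it_v`, `K_v`-type `(p,q)`, `m = p − q`).  THEN `Im s = 0 ∨ Re s = ½`; for a pole `z₀ ∈ (½, 1]` this says `t_v = 0`.  (★ F3 `im_eq_zero_of_isUnitary_matrixCoeff` ∘ ★ F2a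
`archTorusCoeff_inv` ∘ the expansion.)  [cite: Bump1997, §2.6 Thm. 2.6.3] [cite: MoeglinWaldspurger1995, IV.3 and V.3.13] [cite: Knapp1986, VII §1] -/
theorem arch_unitarity_of_matrixCoeff {G : Type*} [Group G] {H : Type*} [NormedAddCommGroup H] [InnerProductSpace ℂ H] [CompleteSpace H]
    {ρ : ContRepresentation ℂ G H} (hρ : ρ.IsUnitary) (t : ℝ → G) (ht : ∀ a : ℝ, 0 < a → t a⁻¹ = (t a)⁻¹)
    {ψ : H} (hψ : ψ ≠ 0) {s : ℂ} {m : ℤ}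
    (hmc : ∀ a : ℝ, 0 < a → ⟪ρ (t a) ψ, ψ⟫_ℂ = archTorusCoeff s m a * ((‖ψ‖ ^ 2 : ℝ) : ℂ)) :
    s.im = 0 ∨ s.re = 1 / 2 :=
  im_eq_zero_or_re_eq_half_of_forall_im_archTorusCoeff_eq_zero fun _ ha =>
    im_eq_zero_of_isUnitary_matrixCoeff hρ t ht hψ (archTorusCoeff s m) (fun a _ => archTorusCoeff_inv s m a) hmc ha

/-- **ARCH-UNITARITY FOR THE RIGHT REGULAR REPRESENTATION ON `L²(G(F)∖G(𝔸), μ)`** (every ★ adelic group datum; E1: `quasiSplit L⁺ L c 2`, `t` the split torus of `U(1,1)` at one real place,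
`ψ = Res_{z₀} E(χ, φ_κ ⊗ φ^v)`): the letter `hmc` with `Φ_{s,m}` forces `Im s = 0 ∨ Re s = ½`. [cite: MoeglinWaldspurger1995, IV.3 and V.3.13] [cite: Bump1997, §2.6 Thm. 2.6.3] -/
theorem arch_unitarity_of_rightRegular_matrixCoeff {K : Type} [Field K] [NumberField K] (𝒢 : Literature.NumberTheory.Automorphic.AdelicGroupData.{0} K)
    (μ : Measure 𝒢.automorphicQuotient) [SMulInvariantMeasure 𝒢.Adelic 𝒢.automorphicQuotient μ]
    (t : ℝ → 𝒢.Adelic) (ht : ∀ a : ℝ, 0 < a → t a⁻¹ = (t a)⁻¹) {ψ : 𝒢.L2 μ} (hψ : ψ ≠ 0) {s : ℂ} {m : ℤ}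
    (hmc : ∀ a : ℝ, 0 < a → ⟪𝒢.rightRegular μ (t a) ψ, ψ⟫_ℂ = archTorusCoeff s m a * ((‖ψ‖ ^ 2 : ℝ) : ℂ)) :
    s.im = 0 ∨ s.re = 1 / 2 :=
  arch_unitarity_of_matrixCoeff (𝒢.isUnitary_rightRegular μ) t ht hψ hmc

end Summit.HodgeConjecture.HodgeConjecture.Cruxes.H413.K2E1ArchTorusCoefficientExpansionU11

end
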